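import Literature.Computability.Complexity.ThreeCNFCompiler
import HarnessLib

/-!
# Skeleton reductions in table mode (small input lengths)

Literature / circuit complexity (serves `williams_acc` through the leaf
`Williams2014_fact_3_1_skeleton`). The tableau of `SkeletonTableau*.lean` presents
`L ∩ {0,1}ⁿ` by `2ⁿ · poly(n)` clauses only from an `L`-dependent input length on (the constants
of the verifier enter the clause count); below that length the skeleton reduction uses the
brute-force presentation of this file, whose size `n + 2ⁿ (n + 2)` is universal: the unit
clauses `Xⱼ = xⱼ` followed, for every string `z ∈ {0,1}ⁿ` NOT in `L`, by the blocking clause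
`⋁ⱼ (Xⱼ ≠ zⱼ)` — written as a prefix-or ladder of width-`3` clauses
`¬s₀`, `s_{j+1} → s_j ∨ (Xⱼ ≠ zⱼ)`, `sₙ` with fresh variables `s_{z,j}` (Cook 1971 /
Arora–Barak 2009, Lemma 2.14) — and tautologies for the strings in `L`.

* `skTable L n i b` — the clause function; `length_skTable_le`, `vars_skTable_lt`,
  `skTable_taut`;
* **`sat_skTable_iff`** — for `|x| = n`, the presented formula (units from `x`) is satisfiable
  iff `x ∈ L`.
-/

namespace Literature.Computability.Complexity

namespace SkTable

open ThreeCNF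

variable (L : Set (List Bool)) (n : ℕ)

/-- The string of length `n` numbered `z` (bit `j` of `z` is symbol `j`). [folklore] -/
def strOf (z : ℕ) : List Bool := List.ofFn fun j : Fin n => bit j.val z

/-- The number of a string. [folklore] -/
def numOf (x : List Bool) : ℕ := ofBits (fun j => x.getD j false) x.length

/-- `numOf x < 2 ^ |x|`. [folklore] -/
theorem numOf_lt (x : List Bool) : numOf x < 2 ^ x.length := ofBits_lt _ _

/-- The string of the number of `x` is `x`. [folklore] -/
theorem strOf_numOf (x : List Bool) : strOf x.length (numOf x) = x := by
  apply List.ext_getElem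
  · simp [strOf]
  · intro j h1 h2
    simp only [strOf, List.getElem_ofFn, numOf]
    rw [bit_ofBits _ _ _ h2, List.getD_eq_getElem?_getD, List.getElem?_eq_getElem h2]; rfl

/-- Row `z` is *good* if its string belongs to `L`. [folklore] -/
def Good (z : ℕ) : Prop := strOf n z ∈ L

/-- The ladder variable `s_{z,j}`. [folklore] -/
def sv (z j : ℕ) : ℕ := n + z * (n + 1) + j

/-- Slot `t < n + 2` of the blocking ladder of row `z`. [cite: AroraBarak2009, Lemma 2.14] -/
def ladder (z t : ℕ) : Clause ℕ :=
  if t = 0 then [(sv n z 0, false)]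
  else if t ≤ n then [(sv n z t, false), (sv n z (t - 1), true), (t - 1, !bit (t - 1) z)]
  else if t = n + 1 then [(sv n z n, true)]
  else tautClause

open Classical in
/-- **The clause function in table mode**: units `Xᵢ = b` for `i < n`, then for each row
`z < 2ⁿ` a block of `n + 2` slots holding the blocking ladder if the row is not in `L` and
tautologies otherwise; tautologies beyond. [cite: AroraBarak2009, Lemma 2.14] -/
noncomputable def skTable (i : ℕ) (b : Bool) : Clause ℕ :=
  if i < n then [(i, b)]
  else if (i - n) / (n + 2) < 2 ^ n then
    (if Good L n ((i - n) / (n + 2)) then tautClause else ladder n ((i - n) / (n + 2)) ((i - n) % (n + 2)))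
  else tautClause

/-- Number of meaningful clauses. [folklore] -/
def CT : ℕ := n + 2 ^ n * (n + 2)
/-- Bound on the variables. [folklore] -/
def VT : ℕ := n + 2 ^ n * (n + 1)

/-- Table clauses have width at most `3`. [folklore] -/
theorem length_skTable_le (i : ℕ) (b : Bool) : (skTable L n i b).length ≤ 3 := by
  unfold skTable ladder; split_ifs <;> simp

/-- From `CT` on the clauses are `tautClause`. [folklore] -/
theorem skTable_taut {i : ℕ} (hi : CT n ≤ i) (b : Bool) : skTable L n i b = tautClause := by
  unfold CT at hi
  unfold skTable
  have h1 : ¬ i < n := by omega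
  have h2 : ¬ (i - n) / (n + 2) < 2 ^ n := by
    rw [Nat.not_lt]; exact (Nat.le_div_iff_mul_le (by omega)).2 (by omega)
  rw [if_neg h1, if_neg h2]

/-- Ladder variables are below `VT`. [folklore] -/
theorem sv_lt {z j : ℕ} (hz : z < 2 ^ n) (hj : j ≤ n) : sv n z j < VT n := by
  unfold sv VT
  have : z * (n + 1) + j < 2 ^ n * (n + 1) := by
    calc z * (n + 1) + j < z * (n + 1) + (n + 1) := by omega
      _ = (z + 1) * (n + 1) := by ring
      _ ≤ 2 ^ n * (n + 1) := Nat.mul_le_mul_right _ hz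
  omega

/-- All variables of the table clauses are below `VT` (or `0`). [folklore] -/
theorem vars_skTable_lt (i : ℕ) (b : Bool) : ∀ l ∈ skTable L n i b, l.1 < VT n ∨ l.1 = 0 := by
  intro l hl
  unfold skTable at hl
  split_ifs at hl with h1 h2 h3
  · simp only [List.mem_singleton] at hl; subst hl; left; unfold VT; simp only []; omega
  · simp [tautClause] at hl; rcases hl with rfl | rfl <;> simp
  · unfold ladder at hl
    have hn : (i - n) % (n + 2) < n + 2 := Nat.mod_lt _ (by omega)
    split_ifs at hl with h4 h5 h6
    · simp only [List.mem_singleton] at hl; subst hl; exact Or.inl (sv_lt n h2 (Nat.zero_le _))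
    · simp only [List.mem_cons, List.not_mem_nil, or_false] at hl
      rcases hl with rfl | rfl | rfl
      · exact Or.inl (sv_lt n h2 h5)
      · exact Or.inl (sv_lt n h2 (by omega))
      · left; unfold VT; simp only []; omega
    · simp only [List.mem_singleton] at hl; subst hl; exact Or.inl (sv_lt n h2 le_rfl)
    · simp [tautClause] at hl; rcases hl with rfl | rfl <;> simp
  · simp [tautClause] at hl; rcases hl with rfl | rfl <;> simp

/-! ### Correctness -/

/-- Evaluation of a literal. [folklore] -/
theorem eval_lit (σ : ℕ → Bool) (v : ℕ) (b : Bool) : Literal.eval σ (v, b) = (σ v == b) := rfl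

/-- **Soundness of a ladder**: if all its `n + 2` clauses hold, some literal `X_j ≠ z_j` holds.
[folklore] -/
theorem exists_ne_of_ladder {σ : ℕ → Bool} {z : ℕ} (h : ∀ t < n + 2, (ladder n z t).eval σ = true) :
    ∃ j < n, σ j ≠ bit j z := by
  by_contra hall
  push Not at hall
  have hs : ∀ j ≤ n, σ (sv n z j) = false := by
    intro j
    induction j with
    | zero =>
      intro _
      have := h 0 (by omega)
      simp only [ladder, if_true, Clause.eval, List.any_cons, List.any_nil, Bool.or_false, eval_lit] at this
      simpa using this
    | succ j ih =>
      intro hj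
      have h1 := ih (by omega)
      have h2 := hall j (by omega)
      have := h (j + 1) (by omega)
      simp only [ladder, Nat.succ_ne_zero, if_false, show j + 1 ≤ n from hj, if_true, Nat.add_sub_cancel,
        Clause.eval, List.any_cons, List.any_nil, Bool.or_false, eval_lit, h1, h2] at this
      revert this; cases σ (sv n z (j + 1)) <;> cases bit j z <;> simp
  have := h (n + 1) (by omega)
  simp only [ladder, Nat.succ_ne_zero, if_false, show ¬ (n + 1 ≤ n) by omega, if_true, Clause.eval,
    List.any_cons, List.any_nil, Bool.or_false, eval_lit, hs n le_rfl] at this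
  simp at this

/-- The intended values of the ladder variables: `s_{z,j}` = "some `X_i ≠ z_i`, `i < j`".
[folklore] -/
noncomputable def svVal (σ₀ : ℕ → Bool) (z j : ℕ) : Bool := decide (∃ i < j, σ₀ i ≠ bit i z)

/-- **Completeness of a ladder**: with the intended ladder values, a row differing from the
main variables somewhere has all its ladder clauses true. [folklore] -/
theorem ladder_of_ne {σ : ℕ → Bool} {z : ℕ} (hsv : ∀ j ≤ n, σ (sv n z j) = svVal σ z j)
    (hne : ∃ j < n, σ j ≠ bit j z) : ∀ t, (ladder n z t).eval σ = true := by
  intro t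
  unfold ladder
  split_ifs with h0 h1 h2
  · simp only [Clause.eval, List.any_cons, List.any_nil, Bool.or_false, eval_lit, hsv 0 (Nat.zero_le _), svVal]
    simp
  · simp only [Clause.eval, List.any_cons, List.any_nil, Bool.or_false, eval_lit, hsv t h1, hsv (t - 1) (by omega),
      svVal]
    by_cases hex : ∃ i < t, σ i ≠ bit i z
    · -- s_t is true: need s_{t-1} ∨ literal
      obtain ⟨i, hi, hne'⟩ := hex
      by_cases hi' : i < t - 1
      · have : (∃ i < t - 1, σ i ≠ bit i z) := ⟨i, hi', hne'⟩
        simp [this]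
      · have hit : i = t - 1 := by omega
        subst hit
        revert hne'; cases σ (t - 1) <;> cases bit (t - 1) z <;> simp
    · simp [hex]
  · simp only [Clause.eval, List.any_cons, List.any_nil, Bool.or_false, eval_lit, hsv n le_rfl, svVal]
    simpa using hne
  · exact eval_tautClause σ

open Classical in
/-- **Correctness of table mode**: for `|x| = n`, the table clauses with the units read off
`x` are simultaneously satisfiable iff `x ∈ L`. [cite: AroraBarak2009, Lemma 2.14] -/
theorem sat_skTable_iff (x : List Bool) (hx : x.length = n) :
    (∃ σ : ℕ → Bool, ∀ i, (skTable L n i (x.getD i false)).eval σ = true) ↔ x ∈ L := by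
  constructor
  · rintro ⟨σ, hσ⟩
    have hunit : ∀ j < n, σ j = x.getD j false := fun j hj => by
      have := hσ j
      unfold skTable at this; rw [if_pos hj] at this
      simpa [Clause.eval, eval_lit] using this
    by_contra hxL
    -- the row of `x` is bad, so its ladder holds, so `σ` differs from `x` somewhere
    have hz : numOf x < 2 ^ n := hx ▸ numOf_lt x
    have hbad : ¬ Good L n (numOf x) := by unfold Good; rw [← hx, strOf_numOf]; exact hxL
    have hlad : ∀ t < n + 2, (ladder n (numOf x) t).eval σ = true := by
      intro t ht
      have := hσ (n + (numOf x) * (n + 2) + t)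
      unfold skTable at this
      have e1 : n + numOf x * (n + 2) + t - n = (n + 2) * numOf x + t := by ring_nf; omega
      rw [if_neg (by omega), e1, Nat.mul_add_div (by omega), Nat.div_eq_of_lt ht, Nat.add_zero, if_pos hz,
        if_neg hbad, Nat.mul_add_mod, Nat.mod_eq_of_lt ht] at this
      exact this
    obtain ⟨j, hj, hne⟩ := exists_ne_of_ladder n hlad
    apply hne
    rw [hunit j hj, numOf, bit_ofBits _ _ _ (by rw [hx]; exact hj)]
  · intro hxL
    let σ₀ : ℕ → Bool := fun j => x.getD j false
    let σ : ℕ → Bool := fun v => if v < n then σ₀ v else svVal σ₀ ((v - n) / (n + 1)) ((v - n) % (n + 1))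
    have hmain : ∀ j < n, σ j = σ₀ j := fun j hj => by simp only [σ, if_pos hj]
    have hsv : ∀ z, ∀ j ≤ n, σ (sv n z j) = svVal σ₀ z j := fun z j hj => by
      have e1 : n + z * (n + 1) + j - n = (n + 1) * z + j := by ring_nf; omega
      simp only [σ, sv, show ¬ (n + z * (n + 1) + j < n) by omega, if_false, e1, Nat.mul_add_div (by omega : 0 < n + 1),
        Nat.div_eq_of_lt (Nat.lt_succ_of_le hj), Nat.add_zero, Nat.mul_add_mod, Nat.mod_eq_of_lt (Nat.lt_succ_of_le hj)]
    have hsvσ : ∀ z, ∀ j ≤ n, σ (sv n z j) = svVal σ z j := fun z j hj => by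
      rw [hsv z j hj]; unfold svVal
      congr 1; apply propext
      constructor <;> rintro ⟨i, hi, hne⟩ <;> refine ⟨i, hi, ?_⟩
      · rwa [hmain i (by omega)]
      · rwa [hmain i (by omega)] at hne
    refine ⟨σ, fun i => ?_⟩
    unfold skTable
    split_ifs with h1 h2 h3
    · simp [Clause.eval, eval_lit, hmain i h1, σ₀]
    · exact eval_tautClause σ
    · -- a bad row differs from `x ∈ L`
      set z := (i - n) / (n + 2) with hz
      have hne : ∃ j < n, σ j ≠ bit j z := by
        by_contra hall
        push Not at hall
        apply h3
        unfold Good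
        have : strOf n z = x := by
          apply List.ext_getElem
          · simp [strOf, hx]
          · intro j hj1 hj2
            simp only [strOf, List.getElem_ofFn]
            have hjn : j < n := by simpa [strOf] using hj1
            rw [← hall j hjn, hmain j hjn]
            simp only [σ₀]
            rw [List.getD_eq_getElem?_getD, List.getElem?_eq_getElem hj2]; rfl
        rw [this]; exact hxL
      exact ladder_of_ne n (hsvσ z) hne _
    · exact eval_tautClause σ

end SkTable

end Literature.Computability.Complexity
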